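import Literature.MathematicalPhysics.QuantumFieldTheory.Balaban1983to89.B9Eq344CovariantResolventGradientRow
import Literature.MathematicalPhysics.QuantumFieldTheory.Balaban1983to89.B9Eq344FlatWindowGradientLetter
import Literature.MathematicalPhysics.QuantumFieldTheory.Balaban1983to89.B9Eq343ResolventHolderRowTowerOfFlatWindow

/-!
# `Balaban1983to89.B9Eq344ResolventGradientRowTower` — T. Bałaban, *Propagators for lattice gauge theories in a background field*, Commun. Math. Phys. **99** (1985)
# 389–434 [Balaban1985BackgroundPropagators] Thm 3.1 (3.44) p. 398 (*«|(∇_UG′(U)∇\*_Uλ)(x)| ≤ B′₀(ε)(…‖λ‖_ε… + |λ|)»*), (3.23) p. 394, (3.35)–(3.36) p. 396: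
# **(L2) ON THE MODEL — THE `cosh`-WEIGHTED η-SCALE COVARIANT GRADIENT ROW OF `(Δ^η_U + 1)⁻¹D*_U` ON η-`½`-HÖLDER BOND DATA, CLOSED**: `∃ αG ΘG κG` BEFORE the height such
# that for every background of the model's small-field class (`‖U_b − 1‖ ≤ αη`, `‖U(x,μ) − U(x−e_μ,μ)‖ ≤ αη²`, the level letters), every rate `a` in the common window
# (`a·d·L^{n+1} ≤ κG`, `a·L^{n+1} ≤ 1`, `2d(L^{n+1})²(cosh a − 1) ≤ ½`), every centre `x₀` and every bond datum with `‖f(b)‖ ≤ F·W_{x₀}(b₋)` and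
# `‖f(y′,μ) − f(y,μ)‖ ≤ H·W_{x₀}(y)·(d(y,y′)∕L^{n+1})^{½}` (`d(y,y′) ≤ L^{n+1}`): `‖(D_U((Δ^η_U+1)⁻¹D*_Uf))(b)‖ ≤ ΘG·(F + H)·W_{x₀}(b₋)` — the abstract row
# `B9Eq344CovariantResolventGradientRow.gradRow_covariantResolvent_covDiv` with BOTH letters discharged: `HflatG := B9Eq344FlatWindowGradientLetter.flatWindowGradientLetter`
# (the discrete Campanato road `B4Eq19Lattice*` of this lineage) and `Hgrad := B9Eq342ResolventGradLetterTower.exists_gradLetter_resolvent` (gen 93).  This is the one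
# NEW analytic input of the repaired route to STOREY H's `H3` (the third word read literally as `G̃_k(D_UR_kD*_UG̃_kf)`: `H3 ⇐` G̃_k's gradient row on sup data (owner) `∧`
# sup‖D_U(R_kG′_kD*_Uh)‖, `h = G̃_kf`, `⇐` (HX) `∧ D_UG′_kD*_Uh = D_UG^U_1D*_Uh + D_UG^U_1[(1 − a′Q̃′†Q̃′)G′_kD*_Uh]` `⇐` THIS FILE `∧` gen 93's letters) — replacing the
# unsatisfiable Hessian letter (HLb).  NE9 crux-team LEAF PROVER 01, gen 95.

statement-level skeleton of published theorems with citation tags; proofs where landed; nothing here is a claim about the Yang–Mills mass gap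

CITATION HEADER (lean-in-tree rule).  Audit cell `pub-balaban`, sub-cell `t4`, BINDER row NE9; filed by NE9 crux-team LEAF PROVER 01 (`b2b-balaban-t4-ne9-formalise-leaf-01`,
gen 95; bears_on: R4/N22).  Source READ first-hand (`paper:balaban1985-cmp99-background-propagators`, pp. 394–398).  COMPOSED BY NAME (pattern: gen 93's
`B9Eq343ResolventHolderRowTowerOfFlatWindow`): the abstract row, the two letters, the transporter letters `norm_adTransportW_sub_le`, `norm_adTransportW_inv_sub_adTransportW_inv_le`,
`adTransportW_inv_adTransportW`, the flat constant bound `sad_le_sixteen_mul`.  Nothing printed is a hypothesis.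

WHAT IS PROVED (sorry-free; proof lane — 0 `def`).
* **`exists_gradRow_resolvent_covDiv_holder`** — the displayed `∃ αG ΘG κG`-row (constants crude: `ΘG = SG + 48dc + Θg(d(4c·SG + 48d(c²+c)) + 3dc)`, `c = 2M_φM_φ′`).
HONEST SCOPE.  (L2) on the model CLOSED; the re-docking of `H3` (and hence the (117) socket with NO displayed letter) is the successor's file (LOCATED-after-g95 §1).  NOT summit
progress (cell pub-balaban: NE9 NOT PRINTED ∕ NOT PROVED; «NE9 ⇐ the named binders»; row WALLED ON A MODEL (O-NE9-1; #5 UNRULED); spine PROVED 0∕9; rung (B)+1 finite T⁴ — NOT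
infinite volume, NOT mass gap, NOT BetaPertH, NOT Clay).  HONEST DEPENDENCY (cell line): continuum YM on T⁴ ⇐ BetaPertH ∧ nine spine estimates (0/9 proved); BetaPertH ⇐ (D1) ∧
(D4) ∧ CAP+tail; G-an2-4 gates asym, D1 and NE2/3/4.  NEW file; nothing modified.  Net new unproved facts: 0.
-/

noncomputable section

open scoped InnerProductSpace ComplexConjugate BigOperators

namespace Literature.MathematicalPhysics.QuantumFieldTheory.Balaban1983to89.B9Eq344ResolventGradientRowTower

open B4Sect5Torus (TSite tdist tdist_nonneg)
open B4TorusKernel.MultiPeriod (circAbs)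
open B7Prop1Explicit (U1 mem_U1 norm_inv_sub_one_le)
open B9SectCLatticeCarrier (Bond bpos btgt shift unshift)
open B9Eq311L2Pairing (WL2)
open B11Eq103H1Complex (SiteL2K BondL2K covDerivL2K covDivL2K covLaplaceSiteK greenK equiv_covDerivL2K)
open B9Eq33CovDerivVector (covDeriv_apply_dir)
open B9Eq310HessianOperator (adTransportW)
open B9Eq315QTower (towerP towerP_apply UlevOf)
open B9Eq324DeltaPrimeATower (laplacePrimeAk)
open B9Eq342GreenPrimeSupBound (adTransportW_inv_adTransportW norm_adTransportW_eq norm_adTransportW_inv_eq)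
open B9Eq384RemainderLetters (norm_adTransportW_sub_le)
open B9Eq373TransporterLipschitzLetters (norm_adTransportW_inv_sub_adTransportW_inv_le)
open B9Eq342CovariantResolventAdjointRowTower (sad_le_sixteen_mul)
open B9Eq342ResolventGradLetterTower (exists_gradLetter_resolvent)
open B9Eq344CovariantResolventGradientRow (gradRow_covariantResolvent_covDiv)
open B9Eq344FlatWindowGradientLetter (flatWindowGradientLetter)

/-- arithmetic of the constant (outside the big context): with `tε = cα ≤ c`, `S_ad ≤ 16d`, `e^a ≤ 3`, `t²(ε² + ε′) = (cα)² + cα ≤ c² + c`. [folklore] -/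
private theorem const_le {SG Θg c α d S ea : ℝ} (hSG : 0 ≤ SG) (hΘg : 0 ≤ Θg) (hc0 : 0 ≤ c) (hα : 0 ≤ α) (hα1 : α ≤ 1) (hd0 : 0 ≤ d)
    (hS0 : 0 ≤ S) (hS : S ≤ 16 * d) (hea0 : 0 ≤ ea) (hea : ea ≤ 3) :
    SG + c * α * S * ea + Θg * (d * (c * α * SG * (1 + ea) + ((c * α) ^ 2 + c * α) * S * ea) + c * α * d * ea) ≤
      SG + 48 * d * c + Θg * (d * (4 * c * SG + 48 * d * (c ^ 2 + c)) + 3 * d * c) := by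
  have hcα : c * α ≤ c := by nlinarith
  have hcα0 : 0 ≤ c * α := by positivity
  have h1 : c * α * S * ea ≤ 48 * d * c := by
    calc c * α * S * ea ≤ c * (16 * d) * 3 := by
          apply mul_le_mul (mul_le_mul hcα hS hS0 hc0) hea hea0 (by positivity)
      _ = 48 * d * c := by ring
  have h2 : c * α * SG * (1 + ea) ≤ 4 * c * SG := by nlinarith [mul_nonneg hcα0 hSG, mul_nonneg hc0 hSG]
  have h3 : ((c * α) ^ 2 + c * α) * S * ea ≤ 48 * d * (c ^ 2 + c) := by
    have : (c * α) ^ 2 + c * α ≤ c ^ 2 + c := by nlinarith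
    calc ((c * α) ^ 2 + c * α) * S * ea ≤ (c ^ 2 + c) * (16 * d) * 3 := by
          apply mul_le_mul (mul_le_mul this hS hS0 (by positivity)) hea hea0 (by positivity)
      _ = 48 * d * (c ^ 2 + c) := by ring
  have h4 : c * α * d * ea ≤ 3 * d * c := by
    calc c * α * d * ea ≤ c * d * 3 := by apply mul_le_mul (mul_le_mul_of_nonneg_right hcα hd0) hea hea0 (by positivity)
      _ = 3 * d * c := by ring
  have h5 : d * (c * α * SG * (1 + ea) + ((c * α) ^ 2 + c * α) * S * ea) + c * α * d * ea ≤ d * (4 * c * SG + 48 * d * (c ^ 2 + c)) + 3 * d * c :=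
    add_le_add (mul_le_mul_of_nonneg_left (add_le_add h2 h3) hd0) h4
  nlinarith [mul_le_mul_of_nonneg_left h5 hΘg]

variable {d : ℕ} (L : ℕ) [NeZero L] (hL3 : 3 ≤ L)
  {𝔸 : Type*} [NormedRing 𝔸] [NormedAlgebra ℂ 𝔸] [CompleteSpace 𝔸] [NormOneClass 𝔸] [StarRing 𝔸]
  {W : Type*} [NormedAddCommGroup W] [InnerProductSpace ℂ W] [FiniteDimensional ℂ W] (φ : W ≃ₗ[ℂ] 𝔸)
  {a' Mφ Mφ' : ℝ} (hMφ : 0 ≤ Mφ) (hMφ' : 0 ≤ Mφ') (hφ : ∀ w, ‖φ w‖ ≤ Mφ * ‖w‖) (hφ' : ∀ X, ‖φ.symm X‖ ≤ Mφ' * ‖X‖) (ha' : 0 < a')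
  {r : ℝ} (hr0 : 0 ≤ r) (hr1 : r < 1)
  (τ : 𝔸 →ₗ[ℂ] ℂ) (hτ₂ : ∀ X Y : 𝔸, τ (X * Y) = τ (Y * X)) (hφτ : ∀ X Y : 𝔸, ⟪φ.symm X, φ.symm Y⟫_ℂ = τ (star X * Y))

include hL3 hMφ hMφ' hφ hφ' ha' hr0 hr1 hτ₂ hφτ in
/-- **(L2) ON THE MODEL: the `cosh`-weighted η-scale covariant GRADIENT row of `(Δ^η_U + 1)⁻¹D*_U` on η-`½`-Hölder bond data, CLOSED.**  For `1 ≤ d`, `L ≥ 3`: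
`∃ αG ΘG κG` such that for every background of the model with its level letters, any positivity witnesses, every rate `a` with `a·d·L^{n+1} ≤ κG`, `a·L^{n+1} ≤ 1`,
`2d(L^{n+1})²(cosh a − 1) ≤ ½`, every centre `x₀` and every bond datum with `‖f(b)‖ ≤ F·W_{x₀}(b₋)`, `‖f(y′,μ) − f(y,μ)‖ ≤ H·W_{x₀}(y)·(d(y,y′)∕L^{n+1})^{½}` for
`d(y,y′) ≤ L^{n+1}`: `‖(D_U((Δ^η_U+1)⁻¹D*_Uf))(b)‖ ≤ ΘG·(F + H)·W_{x₀}(b₋)` — print's (3.44) `|∇G∇*λ| ≲ ‖λ‖_ε + |λ|` for the covariant massive resolvent, in the weighted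
sup currency. [cite: Balaban1985BackgroundPropagators, Thm 3.1 (3.44) p.398, (3.40) p.397, (3.23) p.394, (3.35)–(3.36) p.396] -/
theorem exists_gradRow_resolvent_covDiv_holder (hd : 1 ≤ d) :
    ∃ αG ΘG κG : ℝ, 0 < αG ∧ 0 ≤ ΘG ∧ 0 < κG ∧
      ∀ (n : ℕ) (η : ℝ), η * (L : ℝ) ^ (n + 1) = 1 →
      ∀ (c₀ c₁ : ℝ) [Fact (0 < c₀)] [Fact (0 < c₁)], c₀ * ((L : ℝ) ^ (n + 1)) ^ d = c₁ →
      ∀ (m : Fin d → ℕ) [∀ i, NeZero (m i)] (U : Bond d (towerP L m (n + 1)) → 𝔸ˣ),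
      ∀ (α : ℝ), 0 ≤ α → α ≤ αG → (∀ b, U b ∈ U1 𝔸) → (∀ b, ‖(U b : 𝔸) - 1‖ ≤ α * η) →
        (∀ (x : TSite d (towerP L m (n + 1))) (μ : Fin d), ‖(U (x, μ) : 𝔸) - U (unshift μ x, μ)‖ ≤ α * η ^ 2) →
      ∀ (εU : ℕ → ℝ), (∀ j, 0 ≤ εU j) → (∀ j < n + 1, εU j ≤ α * r ^ j) →
        (∀ (j : ℕ) (b : Bond d (towerP L m (j + 1))), ‖(UlevOf L m (n + 1) U j b : 𝔸) - 1‖ ≤ εU j) →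
        (∀ (j : ℕ) (b : Bond d (towerP L m (j + 1))), UlevOf L m (n + 1) U j b ∈ U1 𝔸) →
        ∀ (hUst : ∀ b, star (U b : 𝔸) = ((U b)⁻¹ : 𝔸ˣ)),
        (∀ (j : ℕ) (b : Bond d (towerP L m (j + 1))) (w : W), ‖adTransportW φ (UlevOf L m (n + 1) U j) b w‖ ≤ ‖w‖) →
      ∀ (hpos' : ∀ x : SiteL2K ℂ d (towerP L m (n + 1)) c₀ W, x ≠ 0 → 0 < RCLike.re ⟪x, laplacePrimeAk L m n φ η U a' (c₁ := c₁) x⟫_ℂ)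
        (hpos₁ : ∀ x : SiteL2K ℂ d (towerP L m (n + 1)) c₀ W, x ≠ 0 →
          0 < RCLike.re ⟪x, ((covLaplaceSiteK (c₀ := c₀) ((η : ℂ))⁻¹ (adTransportW φ U) (adTransportW φ fun b => (U b)⁻¹) + (1 : ℂ) • LinearMap.id :
            SiteL2K ℂ d (towerP L m (n + 1)) c₀ W →ₗ[ℂ] SiteL2K ℂ d (towerP L m (n + 1)) c₀ W)) x⟫_ℂ)
        (a : ℝ), 0 ≤ a → a * d * (L : ℝ) ^ (n + 1) ≤ κG → a * (L : ℝ) ^ (n + 1) ≤ 1 → 2 * (d : ℝ) * ((L : ℝ) ^ (n + 1)) ^ 2 * (Real.cosh a - 1) ≤ 1 / 2 →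
      ∀ (x₀ : TSite d (towerP L m (n + 1))) (f : BondL2K ℂ d (towerP L m (n + 1)) c₀ W) (F H : ℝ), 0 ≤ F → 0 ≤ H →
        (∀ b, ‖WL2.equiv ℂ (fun _ : Bond d (towerP L m (n + 1)) => c₀) W f b‖ ≤ F * ∏ μ, Real.cosh (a * (circAbs (towerP L m (n + 1) μ)
          ((((x₀ μ : ℕ) : ZMod (towerP L m (n + 1) μ)) - ((bpos b μ : ℕ) : ZMod (towerP L m (n + 1) μ))).val) : ℝ))) →
        (∀ (y y' : TSite d (towerP L m (n + 1))) (μ : Fin d), tdist (towerP L m (n + 1)) y y' ≤ (L : ℝ) ^ (n + 1) →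
          ‖WL2.equiv ℂ (fun _ : Bond d (towerP L m (n + 1)) => c₀) W f (y', μ) - WL2.equiv ℂ (fun _ : Bond d (towerP L m (n + 1)) => c₀) W f (y, μ)‖ ≤
            H * (∏ μ, Real.cosh (a * (circAbs (towerP L m (n + 1) μ) ((((x₀ μ : ℕ) : ZMod (towerP L m (n + 1) μ)) - ((y μ : ℕ) : ZMod (towerP L m (n + 1) μ))).val) : ℝ))) *
              (tdist (towerP L m (n + 1)) y y' / (L : ℝ) ^ (n + 1)) ^ ((1 : ℝ) / 2)) →
      ∀ b : Bond d (towerP L m (n + 1)),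
        ‖WL2.equiv ℂ (fun _ : Bond d (towerP L m (n + 1)) => c₀) W (covDerivL2K ℂ c₀ ((η : ℂ))⁻¹ (adTransportW φ U)
            (greenK _ hpos₁ (covDivL2K ℂ c₀ ((η : ℂ))⁻¹ (adTransportW φ fun b => (U b)⁻¹) f))) b‖ ≤
          ΘG * (F + H) * ∏ μ, Real.cosh (a * (circAbs (towerP L m (n + 1) μ)
            ((((x₀ μ : ℕ) : ZMod (towerP L m (n + 1) μ)) - ((bpos b μ : ℕ) : ZMod (towerP L m (n + 1) μ))).val) : ℝ)) := by
  classical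
  have hL2 : 2 ≤ L := le_trans (by norm_num) hL3
  -- the two letters and the constants
  obtain ⟨αg, Θg, κg, hαg, hΘg, hκg, HG⟩ := exists_gradLetter_resolvent L hL3 φ hMφ hMφ' hφ hφ' ha' hr0 hr1 τ hτ₂ hφτ hd
  obtain ⟨SG, hSG, HF⟩ := flatWindowGradientLetter (d := d) L (W := W) hL2
  obtain ⟨c, hc⟩ : ∃ c : ℝ, c = 2 * Mφ * Mφ' := ⟨_, rfl⟩
  have hc0 : 0 ≤ c := by rw [hc]; positivity
  have hd0 : (0 : ℝ) ≤ d := Nat.cast_nonneg d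
  refine ⟨min 1 αg, SG + 48 * d * c + Θg * (d * (4 * c * SG + 48 * d * (c ^ 2 + c)) + 3 * d * c), κg, lt_min one_pos hαg, by positivity, hκg, ?_⟩
  intro n η hηL c₀ c₁ _ _ hw m _ U α hα hαle hUb hUη hUgrad εU hεU hεg hUε hLb hUst hRlev hpos' hpos₁ a ha0 haκ haK1 hlamK x₀ f F H hF hH hf hfH b
  have hα1 : α ≤ 1 := hαle.trans (min_le_left _ _)
  have hαg' : α ≤ αg := hαle.trans (min_le_right _ _)
  -- the scale letters
  have hK1 : (1 : ℝ) ≤ (L : ℝ) ^ (n + 1) := one_le_pow₀ (by exact_mod_cast (by omega : 1 ≤ L))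
  have hK0 : (0 : ℝ) < (L : ℝ) ^ (n + 1) := lt_of_lt_of_le one_pos hK1
  have hη0 : 0 < η := by nlinarith only [hηL, hK0]
  have hηK : η⁻¹ = (L : ℝ) ^ (n + 1) := inv_eq_of_mul_eq_one_right hηL
  have hm1 : ∀ i, 1 ≤ m i := fun i => Nat.one_le_iff_ne_zero.mpr (NeZero.ne (m i))
  have hP : ∀ ν : Fin d, η⁻¹ ≤ (towerP L m (n + 1) ν : ℝ) := fun ν => by
    rw [hηK, towerP_apply, Nat.cast_mul, Nat.cast_pow]
    exact le_mul_of_one_le_right hK0.le (by exact_mod_cast hm1 ν)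
  have hn2 : ∀ ν : Fin d, 2 ≤ towerP L m (n + 1) ν := fun ν => by
    rw [towerP_apply]
    calc 2 ≤ L ^ 1 * 1 := by rw [pow_one, mul_one]; omega
      _ ≤ L ^ (n + 1) * m ν := Nat.mul_le_mul (Nat.pow_le_pow_right (by omega) (by omega)) (hm1 ν)
  -- the rate letters
  have hat : a * η⁻¹ ≤ 1 := by rw [hηK]; exact haK1
  have ha1 : a ≤ 1 := by nlinarith only [haK1, hK1, ha0]
  have hlam : 1 / 2 ≤ 1 - 2 * (d : ℝ) * η⁻¹ ^ 2 * (Real.cosh a - 1) := by rw [hηK]; linarith only [hlamK]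
  have hlam' : 2 * (d : ℝ) * η⁻¹ ^ 2 * (Real.cosh a - 1) < 1 := by linarith only [hlam]
  have hlamh : 2 * (d : ℝ) * η⁻¹ ^ 2 * (Real.cosh a - 1) ≤ 1 / 2 := by linarith only [hlam]
  have hea : Real.exp a ≤ 3 := (Real.exp_le_exp.2 ha1).trans (by have := Real.exp_one_lt_d9; linarith only [this])
  -- the transporter letters
  have hUbinv : ∀ b, (U b)⁻¹ ∈ U1 𝔸 := fun b => by
    have h := mem_U1.1 (hUb b); rw [mem_U1, inv_inv]; exact ⟨h.2, h.1⟩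
  have hRε : ∀ b w, ‖adTransportW φ U b w - w‖ ≤ c * (α * η) * ‖w‖ := fun b w => by
    have h := norm_adTransportW_sub_le φ hφ hφ' hMφ' U b (hUb b) (hUη b) w; rw [hc]; linarith only [h]
  have hSε : ∀ b w, ‖adTransportW φ (fun bb => (U bb)⁻¹) b w - w‖ ≤ c * (α * η) * ‖w‖ := fun b w => by
    have h := norm_adTransportW_sub_le φ hφ hφ' hMφ' (fun bb => (U bb)⁻¹) b (hUbinv b) ((norm_inv_sub_one_le (hUb b)).trans (hUη b)) w
    rw [hc]; linarith only [h]
  have hSε' : ∀ (y : TSite d (towerP L m (n + 1))) (μ : Fin d) (w : W),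
      ‖adTransportW φ (fun bb => (U bb)⁻¹) (y, μ) w - adTransportW φ (fun bb => (U bb)⁻¹) (unshift μ y, μ) w‖ ≤ c * (α * η ^ 2) * ‖w‖ := fun y μ w => by
    have h := norm_adTransportW_inv_sub_adTransportW_inv_le φ hφ hφ' hMφ' U U (y, μ) (unshift μ y, μ) (hUb _) (hUb _) w
    have h2 : 2 * Mφ * Mφ' * ‖(U (y, μ) : 𝔸) - (U (unshift μ y, μ) : 𝔸)‖ * ‖w‖ ≤ c * (α * η ^ 2) * ‖w‖ := by
      rw [hc]; exact mul_le_mul_of_nonneg_right (mul_le_mul_of_nonneg_left (hUgrad y μ) (by positivity)) (norm_nonneg w)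
    exact h.trans h2
  -- the flat constant
  have hSad := sad_le_sixteen_mul (towerP L m (n + 1)) (t := η⁻¹) (a := a) (by rw [hηK]; exact hK1) ha0 ha1 hat hlam hP
  have hSad0 := B9Eq342CovariantResolventAdjointRow.sad_nonneg (P := towerP L m (n + 1)) η⁻¹ (inv_pos.2 hη0) (m := 1) ha0 hlam' _ rfl
  have htε : η⁻¹ * (c * (α * η)) = c * α := by field_simp
  have htε' : η⁻¹ ^ 2 * ((c * (α * η)) ^ 2 + c * (α * η ^ 2)) = (c * α) ^ 2 + c * α := by field_simp
  -- THE ABSTRACT GRADIENT ROW, instantiated (`t = η⁻¹`, `m = 1`, `ℓ = L^{n+1}`, `β = ½`)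
  have hmain := gradRow_covariantResolvent_covDiv (P := towerP L m (n + 1)) (c₀ := c₀) (W := W) η⁻¹ (inv_pos.2 hη0) (m := 1) (a := a)
    (ε := c * (α * η)) (ε' := c * (α * η ^ 2)) (ℓ := (L : ℝ) ^ (n + 1)) (β := (1 : ℝ) / 2) one_pos ha0 (by positivity) (by positivity) hlam' hn2
    (adTransportW φ U) (adTransportW φ fun b => (U b)⁻¹) (fun b w => adTransportW_inv_adTransportW φ U b w)
    hRε hSε hSε'
    (fun x₀ y => ∏ μ, Real.cosh (a * (circAbs (towerP L m (n + 1) μ)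
      ((((x₀ μ : ℕ) : ZMod (towerP L m (n + 1) μ)) - ((y μ : ℕ) : ZMod (towerP L m (n + 1) μ))).val) : ℝ))) (fun _ _ => rfl) _ rfl
    ((covLaplaceSiteK (c₀ := c₀) ((η : ℂ))⁻¹ (adTransportW φ U) (adTransportW φ fun b => (U b)⁻¹) + (1 : ℂ) • LinearMap.id :
      SiteL2K ℂ d (towerP L m (n + 1)) c₀ W →ₗ[ℂ] SiteL2K ℂ d (towerP L m (n + 1)) c₀ W))
    (by rw [Complex.ofReal_inv, Complex.ofReal_one]) hpos₁ SG hSG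
    (fun x₁ u g G Hg hG hHg hu hg hgH bb => by
      -- the flat letter: `‖D_1u(bb)‖ = L^{n+1}‖u(bb₊) − u(bb₋)‖`
      have h1 := HF n η hηL c₀ m a ha0 haK1 hlamK x₁ u g G Hg hG hHg hu hg hgH (bpos bb) bb.2
      obtain ⟨x, μ⟩ := bb
      have e : ‖WL2.equiv ℂ (fun _ : Bond d (towerP L m (n + 1)) => c₀) W
          (covDerivL2K ℂ c₀ ((η⁻¹ : ℝ) : ℂ) (fun _ : Bond d (towerP L m (n + 1)) => (LinearMap.id : W →ₗ[ℂ] W)) u) (x, μ)‖ =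
          (L : ℝ) ^ (n + 1) * ‖WL2.equiv ℂ (fun _ : TSite d (towerP L m (n + 1)) => c₀) W u (shift μ x) -
            WL2.equiv ℂ (fun _ : TSite d (towerP L m (n + 1)) => c₀) W u x‖ := by
        rw [equiv_covDerivL2K, covDeriv_apply_dir, LinearMap.id_apply, norm_smul, Complex.norm_real, Real.norm_eq_abs,
          abs_of_pos (inv_pos.2 hη0), hηK]
      rw [e]; exact h1)
    Θg hΘg
    (fun x₁ g Gs hGs hg bb => by
      rw [Complex.ofReal_inv]
      exact HG n η hηL c₀ c₁ hw m U α hα hαg' hUb hUη hUgrad εU hεU hεg hUε hLb hUst hRlev hpos' hpos₁ a ha0 haκ hlamh x₁ g Gs hGs hg bb)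
    x₀ f F H hF hH hf hfH b
  rw [Complex.ofReal_inv] at hmain
  refine hmain.trans (mul_le_mul_of_nonneg_right (mul_le_mul_of_nonneg_right ?_ (by positivity))
    (Finset.prod_nonneg fun _ _ => (Real.cosh_pos _).le))
  -- the constant
  rw [show η⁻¹ * (c * (α * η)) * _ * Real.exp a = c * α * _ * Real.exp a by rw [htε],
    show η⁻¹ ^ 2 * ((c * (α * η)) ^ 2 + c * (α * η ^ 2)) = (c * α) ^ 2 + c * α from htε',
    show η⁻¹ * (c * (α * η)) * SG = c * α * SG by rw [htε], show η⁻¹ * (c * (α * η)) * (d : ℝ) = c * α * d by rw [htε]]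
  exact const_le hSG hΘg hc0 hα hα1 hd0 hSad0 hSad (Real.exp_pos a).le hea

end Literature.MathematicalPhysics.QuantumFieldTheory.Balaban1983to89.B9Eq344ResolventGradientRowTower

end
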